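import Summits.ResolutionOfSingularities.ResolutionOfSingularities.Theorems.EquisingularLiftEquisingularLiftNatExceptionalLineCone
import Literature.AlgebraicGeometry.Resolution.BlowupAlgebraQuasiRegularChart
import Literature.AlgebraicGeometry.Resolution.BlowupStrictTransform
import HarnessLib

/-!
# [OURS · L1 W4.5(b) · EL♮] T-E1-CONE, ring core: the strict transform of the surface contains the exceptional
# line of a doubled-plane cone — UPSTAIRS, i.e. modulo the uniformizer (the `ϖ`-lifted H-CONE)

Crux `EquisingularLiftNat` = stmt-ResolutionOfSingularities-20038 (route `EquisingularLift`, chain w45b), line `sections`, stub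
`stub_elnat_three_isolated_nonabs` (and the child item EL♮(3)); helper `--supports … --as helper` by res-L1-w45b-stub-1
(T-E1-CONE, 2026-08-27T07:29Z, piece (E-a)). OURS: replaces the role of NOTHING in H. Hironaka's manuscript and is NOT a
statement of it; AI-written kernel lemma, weaker than expert review.

WHAT IT IS FOR. In the HorizChainE1 currency (res-L1-w45b-lead-2) an in-carrier centre `C` at stage 2 (the `O`-line
`ℓ̃ = E_s ∩ St(Π̃)` of `…NatInCarrierCentre.lean`, the Δ-centres of T-CARRIER-Δ) must satisfy E1: «the special-fibre points of
`supp C` lie on the running strict transform `S₂ = closure τ⁻¹(Y′ ∖ range s)`». Read on the chart algebras at a point `x′` over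
`s₀` (dictionary `𝒪_{X₂,x′} ≅ R[I/cᵢ]_𝔔`, p506193; `R = 𝒪_{X₁,s₀}`, `I = (c) = (s.ker)_{s₀}`), membership `x′ ∈ S₂` follows
from `𝔔 ⊇ satᵢ := {g | ∃ N, cᵢᴺ g ∈ (ϖ, F)·R[I/cᵢ]}` where `(𝓘_{Y′})_{s₀} = (ϖ, F)` (the running strict transform is a
hypersurface of the regular special fibre near the good point `s₀`). This file bounds that saturation FROM ABOVE by the ideal of
the exceptional line of the carrier:

  **`satᵢ ⊆ (c_j/cᵢ, cᵢ, ϖ)·R[I/cᵢ]`** whenever the tangent cone of `Y′ ⊆ X_{1,k}` at `s₀` is the DOUBLED CARRIER PLANE,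
  `F ≡ u·c_j² (mod I³ + ϖR)`, `u` a unit (`theorem saturation_le_exceptionalLine_of_doubledPlaneCone`).

So every point of the special fibre of the in-carrier line `V(c_j/cᵢ, cᵢ)` (`ϖ ∈ 𝔔` automatically over `s₀`) lies on `S₂`:
clause (e) of the step. The case `d = 1` (doubled PLANE) covers the quartic specimen `x₀²x₃² + x₁⁴ + x₂⁴` (T-ISO-1: cone `x₀²`)
and every «cone = doubled carrier plane» point (H-CONE, CRUX-PLAN v3 §1.7); the doubled degree-`d` cone `u·Φ(c)²` of T-CARRIER-Δ
is the same argument with `…ExceptionalLineCone`'s `e²` replaced by `Φ²` (not done here).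

PROOF. Reduce modulo `ϖ`: the map of affine blowup algebras `θ : R[I/cᵢ] → R̄[Ī/c̄ᵢ]` along `R → R̄ = R/ϖ` (`blowupAlgebraMap`,
Görtz–Wedhorn 13.96 (2)) is surjective with kernel the `cᵢ`-saturation of `ϖ·R[I/cᵢ]`, which is `ϖ·R[I/cᵢ]` itself because `ϖ`
is a non-zero-divisor modulo `cᵢ` (`R[I/cᵢ]/(cᵢ) ≅ (R/I)[T]` is a domain, Stacks 0BIQ, `blowupAlgebraQuotEquiv`) —
`theorem map_span_uniformizer_saturated`; downstairs `θ(satᵢ)` lies in the kernel of `R̄[Ī/c̄ᵢ] → (R̄/F̄)[…]`, which is contained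
in `(c̄_j/c̄ᵢ, c̄ᵢ)` by H-CONE (`exceptionalLine_subset_strictTransform_of_doubledPlaneCone`, p499011); lift back along `θ`.

* `map_span_uniformizer_saturated` — `cᵢᴺ·h ∈ ϖ·R[I/cᵢ] ⇒ h ∈ ϖ·R[I/cᵢ]` (`c` quasi-regular, `R/I` a domain, `ϖ ∉ I`);
* `ker_blowupAlgebraMap_quotient_uniformizer` — `ker θ = ϖ·R[I/cᵢ]`;
* `saturation_le_exceptionalLine_of_doubledPlaneCone` — the bound above;
* `saturation_le_of_exceptionalLine_le` — the consumer's form: for any ideal `𝔔 ∋ c_j/cᵢ, cᵢ, ϖ` of `R[I/cᵢ]`, `satᵢ ⊆ 𝔔`.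
References: The Stacks Project, Tag 0BIQ; U. Görtz, T. Wedhorn, *Algebraic Geometry I* (2nd ed.), Prop. 13.96 (2).
-/

set_option linter.dupNamespace false -- mandated namespace `Summit.<Summit>.<Problem>` of this single-conjunct summit

noncomputable section

namespace Summit.ResolutionOfSingularities.ResolutionOfSingularities.Cruxes.EquisingularLiftNat.Sections

open IsLocalization Literature.AlgebraicGeometry.Resolution

universe u

variable {R : Type u} [CommRing R] {r : ℕ} (c : Fin r → R) (i : Fin r)

/-! ## `ϖ·R[I/cᵢ]` is `cᵢ`-saturated -/

/-- **`ϖ` is a non-zero-divisor modulo `cᵢ` on the chart**: if `ϖ·y ∈ (cᵢ)·R[I/cᵢ]` then `y ∈ (cᵢ)·R[I/cᵢ]` — because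
`R[I/cᵢ]/(cᵢ) ≅ (R/I)[T_j : j ≠ i]` (Stacks 0BIQ) is a domain in which `ϖ̄ ≠ 0`. [cite: StacksProject, Tag 0BIQ] -/
theorem mem_span_exceptional_of_uniformizer_mul_mem (hc : IsQuasiRegular c)
    [IsDomain (R ⧸ Ideal.span (Set.range c))] {ϖ : R} (hϖ : ϖ ∉ Ideal.span (Set.range c))
    {y : blowupAlgebra (Ideal.span (Set.range c)) (c i)}
    (hy : algebraMap R (blowupAlgebra (Ideal.span (Set.range c)) (c i)) ϖ * y ∈
      Ideal.span {algebraMap R (blowupAlgebra (Ideal.span (Set.range c)) (c i)) (c i)}) :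
    y ∈ Ideal.span {algebraMap R (blowupAlgebra (Ideal.span (Set.range c)) (c i)) (c i)} := by
  set e := blowupAlgebraQuotEquiv c i hc with he
  rw [← Ideal.Quotient.eq_zero_iff_mem] at hy ⊢
  rw [map_mul] at hy
  -- transport to the polynomial ring `(R/I)[T]`, a domain
  have h1 : e.symm (Ideal.Quotient.mk _ (algebraMap R (blowupAlgebra (Ideal.span (Set.range c)) (c i)) ϖ)) =
      MvPolynomial.C (Ideal.Quotient.mk (Ideal.span (Set.range c)) ϖ) := by
    rw [RingEquiv.symm_apply_eq, he, blowupAlgebraQuotEquiv_C]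
  have hne : MvPolynomial.C (σ := {j : Fin r // j ≠ i}) (Ideal.Quotient.mk (Ideal.span (Set.range c)) ϖ) ≠ 0 := by
    rw [Ne, MvPolynomial.C_eq_zero, Ideal.Quotient.eq_zero_iff_mem]
    exact hϖ
  have h2 : e.symm (Ideal.Quotient.mk _ (algebraMap R (blowupAlgebra (Ideal.span (Set.range c)) (c i)) ϖ)) *
      e.symm (Ideal.Quotient.mk _ y) = 0 := by
    rw [← map_mul, hy, map_zero]
  rw [h1] at h2
  rcases mul_eq_zero.mp h2 with h | h
  · exact absurd h hne
  · simpa using congrArg e h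

/-- **`ϖ·R[I/cᵢ]` is `cᵢ`-saturated**: `cᵢᴺ·h ∈ ϖ·R[I/cᵢ] ⇒ h ∈ ϖ·R[I/cᵢ]` (`c` quasi-regular, `R/I` a domain, `ϖ ∉ I`):
`cᵢ` is a non-zero-divisor of `R[I/cᵢ]` and `ϖ` is a non-zero-divisor modulo `cᵢ`. [folklore] -/
theorem map_span_uniformizer_saturated (hc : IsQuasiRegular c) [IsDomain (R ⧸ Ideal.span (Set.range c))]
    {ϖ : R} (hϖ : ϖ ∉ Ideal.span (Set.range c)) {N : ℕ} {h : blowupAlgebra (Ideal.span (Set.range c)) (c i)}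
    (hh : algebraMap R (blowupAlgebra (Ideal.span (Set.range c)) (c i)) (c i) ^ N * h ∈
      (Ideal.span {ϖ}).map (algebraMap R (blowupAlgebra (Ideal.span (Set.range c)) (c i)))) :
    h ∈ (Ideal.span {ϖ}).map (algebraMap R (blowupAlgebra (Ideal.span (Set.range c)) (c i))) := by
  rw [Ideal.map_span, Set.image_singleton] at hh ⊢
  induction N generalizing h with
  | zero => simpa using hh
  | succ N ih =>
    apply ih
    -- `cᵢ · (cᵢᴺ h) = ϖ · h'` with `ϖ h' ∈ (cᵢ)`, so `h' = cᵢ h''` and `cᵢᴺ h = ϖ h''`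
    rw [pow_succ', mul_assoc] at hh
    obtain ⟨h', hh'⟩ := Ideal.mem_span_singleton'.mp hh
    have hmem : algebraMap R (blowupAlgebra (Ideal.span (Set.range c)) (c i)) ϖ * h' ∈
        Ideal.span {algebraMap R (blowupAlgebra (Ideal.span (Set.range c)) (c i)) (c i)} := by
      rw [mul_comm, hh']
      exact Ideal.mul_mem_right _ _ (Ideal.mem_span_singleton_self _)
    obtain ⟨h'', hh''⟩ := Ideal.mem_span_singleton'.mp (mem_span_exceptional_of_uniformizer_mul_mem c i hc hϖ hmem)
    rw [Ideal.mem_span_singleton']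
    refine ⟨h'', ?_⟩
    have hreg := algebraMap_mem_nonZeroDivisors_blowupAlgebra (I := Ideal.span (Set.range c)) (a := c i)
    apply (mul_cancel_left_mem_nonZeroDivisors hreg).mp
    calc algebraMap R (blowupAlgebra (Ideal.span (Set.range c)) (c i)) (c i) *
          (h'' * algebraMap R (blowupAlgebra (Ideal.span (Set.range c)) (c i)) ϖ)
        = (h'' * algebraMap R (blowupAlgebra (Ideal.span (Set.range c)) (c i)) (c i)) *
            algebraMap R (blowupAlgebra (Ideal.span (Set.range c)) (c i)) ϖ := by ring
      _ = h' * algebraMap R (blowupAlgebra (Ideal.span (Set.range c)) (c i)) ϖ := by rw [hh'']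
      _ = _ := hh'

/-- **The kernel of `θ : R[I/cᵢ] → R̄[Ī/c̄ᵢ]`, `R̄ = R/ϖ`, is `ϖ·R[I/cᵢ]`** (it is the `cᵢ`-saturation of `ϖ·R[I/cᵢ]`,
`mem_ker_blowupAlgebraMap_iff`, and that ideal is saturated). [cite: GortzWedhorn2020, Prop. 13.96 (2) (proof), p. 416] -/
theorem ker_blowupAlgebraMap_quotient_uniformizer (hc : IsQuasiRegular c) [IsDomain (R ⧸ Ideal.span (Set.range c))]
    {ϖ : R} (hϖ : ϖ ∉ Ideal.span (Set.range c)) (J : Ideal (R ⧸ Ideal.span {ϖ}))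
    (hIJ : (Ideal.span (Set.range c)).map (Ideal.Quotient.mk (Ideal.span {ϖ})) ≤ J) :
    RingHom.ker (blowupAlgebraMap (Ideal.Quotient.mk (Ideal.span {ϖ})) (Ideal.span (Set.range c)) J (c i) hIJ) =
      (Ideal.span {ϖ}).map (algebraMap R (blowupAlgebra (Ideal.span (Set.range c)) (c i))) := by
  apply le_antisymm
  · intro g hg
    obtain ⟨N, hN⟩ := (mem_ker_blowupAlgebraMap_iff _ _ _ _ hIJ g).mp hg
    rw [Ideal.mk_ker] at hN
    exact map_span_uniformizer_saturated c i hc hϖ hN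
  · rw [Ideal.map_le_iff_le_comap]
    intro a ha
    rw [Ideal.mem_comap, RingHom.mem_ker, blowupAlgebraMap_algebraMap, Ideal.Quotient.eq_zero_iff_mem.mpr ha, map_zero]

/-! ## The saturation of `(ϖ, F)` lies in the ideal of the exceptional line -/

/-- **T-E1-CONE, ring core (`d = 1`).** Let `c` be quasi-regular in `R` with `R/I` a domain (`I = (c)`), `ϖ ∉ I`, and suppose
the images `c̄` in `R̄ = R/ϖ` are quasi-regular with `R̄/Ī` a domain. If `F ≡ u·c_j² (mod I³ + ϖR)` with `ū ∉ Ī` and `j ≠ i`, then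
on the chart `R[I/cᵢ]`: every `g` with `cᵢᴺ·g ∈ (ϖ, F)·R[I/cᵢ]` for some `N` lies in `(c_j/cᵢ, cᵢ, ϖ)` — the `cᵢ`-saturation of
`(ϖ, F)` (whose zero set is the strict transform of `V(ϖ, F)`) is contained in the ideal of the special fibre of the exceptional
line of the carrier `{c_j = 0}`. [folklore; OURS assembly of H-CONE p499011 and Stacks 0BIQ] -/
theorem saturation_le_exceptionalLine_of_doubledPlaneCone (j : Fin r) (hji : j ≠ i) (hc : IsQuasiRegular c)
    [IsDomain (R ⧸ Ideal.span (Set.range c))] {ϖ : R} (hϖ : ϖ ∉ Ideal.span (Set.range c))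
    (hcbar : IsQuasiRegular fun l => Ideal.Quotient.mk (Ideal.span {ϖ}) (c l))
    [IsDomain ((R ⧸ Ideal.span {ϖ}) ⧸ Ideal.span (Set.range fun l => Ideal.Quotient.mk (Ideal.span {ϖ}) (c l)))]
    {u F : R} (hu : Ideal.Quotient.mk (Ideal.span {ϖ}) u ∉
      Ideal.span (Set.range fun l => Ideal.Quotient.mk (Ideal.span {ϖ}) (c l)))
    (hF : F - u * c j ^ 2 ∈ Ideal.span (Set.range c) ^ 3 ⊔ Ideal.span {ϖ})
    {g : blowupAlgebra (Ideal.span (Set.range c)) (c i)} {N : ℕ}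
    (hg : algebraMap R (blowupAlgebra (Ideal.span (Set.range c)) (c i)) (c i) ^ N * g ∈
      (Ideal.span {ϖ, F}).map (algebraMap R (blowupAlgebra (Ideal.span (Set.range c)) (c i)))) :
    g ∈ Ideal.span {blowupAlgebra.frac c i j, algebraMap R (blowupAlgebra (Ideal.span (Set.range c)) (c i)) (c i),
      algebraMap R (blowupAlgebra (Ideal.span (Set.range c)) (c i)) ϖ} := by
  -- the reduction map `θ : R[I/cᵢ] → R̄[Ī/c̄ᵢ]` along `q : R → R/ϖ`
  have hIJ' : (Ideal.span (Set.range c)).map (Ideal.Quotient.mk (Ideal.span {ϖ})) =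
      Ideal.span (Set.range fun l => Ideal.Quotient.mk (Ideal.span {ϖ}) (c l)) := by
    rw [Ideal.map_span, ← Set.range_comp]
    rfl
  have hIJ := hIJ'.le
  have hθsurj : Function.Surjective (blowupAlgebraMap (Ideal.Quotient.mk (Ideal.span {ϖ})) (Ideal.span (Set.range c))
      (Ideal.span (Set.range fun l => Ideal.Quotient.mk (Ideal.span {ϖ}) (c l))) (c i) hIJ) :=
    blowupAlgebraMap_surjective _ _ _ _ Ideal.Quotient.mk_surjective hIJ hIJ'.ge
  have hθa : ∀ a : R, blowupAlgebraMap (Ideal.Quotient.mk (Ideal.span {ϖ})) (Ideal.span (Set.range c))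
      (Ideal.span (Set.range fun l => Ideal.Quotient.mk (Ideal.span {ϖ}) (c l))) (c i) hIJ
        (algebraMap R (blowupAlgebra (Ideal.span (Set.range c)) (c i)) a) =
      algebraMap _ _ (Ideal.Quotient.mk (Ideal.span {ϖ}) a) := fun a => blowupAlgebraMap_algebraMap _ _ _ _ hIJ a
  have hθfrac : blowupAlgebraMap (Ideal.Quotient.mk (Ideal.span {ϖ})) (Ideal.span (Set.range c))
      (Ideal.span (Set.range fun l => Ideal.Quotient.mk (Ideal.span {ϖ}) (c l))) (c i) hIJ (blowupAlgebra.frac c i j) =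
      blowupAlgebra.frac (fun l => Ideal.Quotient.mk (Ideal.span {ϖ}) (c l)) i j := by
    rw [blowupAlgebra.frac, blowupAlgebraMap_gen]
  -- downstairs: the image of `g` lies in the kernel of `R̄[Ī/c̄ᵢ] → (R̄/F̄)[…]`, hence in `(c̄_j/c̄ᵢ, c̄ᵢ)` by H-CONE
  have hFbar : Ideal.Quotient.mk (Ideal.span {ϖ}) F - Ideal.Quotient.mk (Ideal.span {ϖ}) u *
      (fun l => Ideal.Quotient.mk (Ideal.span {ϖ}) (c l)) j ^ 2 ∈
      Ideal.span (Set.range fun l => Ideal.Quotient.mk (Ideal.span {ϖ}) (c l)) ^ 3 := by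
    have h1 : Ideal.Quotient.mk (Ideal.span {ϖ}) (F - u * c j ^ 2) ∈
        (Ideal.span (Set.range c) ^ 3 ⊔ Ideal.span {ϖ}).map (Ideal.Quotient.mk (Ideal.span {ϖ})) :=
      Ideal.mem_map_of_mem _ hF
    rw [Ideal.map_sup, Ideal.map_pow, hIJ', Ideal.map_span, Set.image_singleton,
      Ideal.Quotient.eq_zero_iff_mem.mpr (Ideal.mem_span_singleton_self ϖ), Ideal.span_singleton_zero, sup_bot_eq,
      map_sub, map_mul, map_pow] at h1
    exact h1
  have hker : blowupAlgebraMap (Ideal.Quotient.mk (Ideal.span {ϖ})) (Ideal.span (Set.range c))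
      (Ideal.span (Set.range fun l => Ideal.Quotient.mk (Ideal.span {ϖ}) (c l))) (c i) hIJ g ∈
      RingHom.ker (blowupAlgebra.mapQuotient (Ideal.span (Set.range fun l => Ideal.Quotient.mk (Ideal.span {ϖ}) (c l)))
        ((fun l => Ideal.Quotient.mk (Ideal.span {ϖ}) (c l)) i) (Ideal.span {Ideal.Quotient.mk (Ideal.span {ϖ}) F})) := by
    rw [blowupAlgebra.mem_ker_mapQuotient_iff]
    refine ⟨N, ?_⟩
    have h1 := Ideal.mem_map_of_mem (blowupAlgebraMap (Ideal.Quotient.mk (Ideal.span {ϖ})) (Ideal.span (Set.range c))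
      (Ideal.span (Set.range fun l => Ideal.Quotient.mk (Ideal.span {ϖ}) (c l))) (c i) hIJ) hg
    rw [map_mul, map_pow, hθa, Ideal.map_map, Ideal.map_span] at h1
    refine Ideal.span_le.mpr ?_ h1
    rintro _ ⟨a, ha, rfl⟩
    rcases ha with rfl | ha
    · rw [RingHom.comp_apply, hθa, Ideal.Quotient.eq_zero_iff_mem.mpr (Ideal.mem_span_singleton_self _), map_zero]
      exact zero_mem _
    · rw [Set.mem_singleton_iff.mp ha, RingHom.comp_apply, hθa]
      exact Ideal.mem_map_of_mem _ (Ideal.mem_span_singleton_self _)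
  have hdown := exceptionalLine_subset_strictTransform_of_doubledPlaneCone
    (fun l => Ideal.Quotient.mk (Ideal.span {ϖ}) (c l)) i j hcbar hji hu hFbar hker
  -- lift along `θ`
  obtain ⟨a', b', hab⟩ := Ideal.mem_span_pair.mp hdown
  obtain ⟨a, rfl⟩ := hθsurj a'
  obtain ⟨b, rfl⟩ := hθsurj b'
  have hdiff : g - (a * blowupAlgebra.frac c i j + b * algebraMap R (blowupAlgebra (Ideal.span (Set.range c)) (c i)) (c i)) ∈
      RingHom.ker (blowupAlgebraMap (Ideal.Quotient.mk (Ideal.span {ϖ})) (Ideal.span (Set.range c))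
        (Ideal.span (Set.range fun l => Ideal.Quotient.mk (Ideal.span {ϖ}) (c l))) (c i) hIJ) := by
    rw [RingHom.mem_ker, map_sub, map_add, map_mul, map_mul, hθfrac, hθa, hab, sub_self]
  rw [ker_blowupAlgebraMap_quotient_uniformizer c i hc hϖ _ hIJ, Ideal.map_span, Set.image_singleton] at hdiff
  have hsplit : g = (a * blowupAlgebra.frac c i j + b * algebraMap R (blowupAlgebra (Ideal.span (Set.range c)) (c i)) (c i)) +
      (g - (a * blowupAlgebra.frac c i j + b * algebraMap R (blowupAlgebra (Ideal.span (Set.range c)) (c i)) (c i))) := by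
    ring
  rw [hsplit]
  refine Ideal.add_mem _ (Ideal.add_mem _ ?_ ?_) ?_
  · exact Ideal.mul_mem_left _ _ (Ideal.subset_span (by simp))
  · exact Ideal.mul_mem_left _ _ (Ideal.subset_span (by simp))
  · exact Ideal.span_mono (by simp) hdiff

/-- **Consumer's form**: with the hypotheses of `saturation_le_exceptionalLine_of_doubledPlaneCone`, any ideal `𝔔` of the
chart ring containing `c_j/cᵢ`, `cᵢ` and `ϖ` (a point of the special fibre of the exceptional line of the carrier, read through
the dictionary `𝒪_{X₂,x′} ≅ R[I/cᵢ]_𝔔`) contains the whole `cᵢ`-saturation of `(ϖ, F)` — so the point lies on the strict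
transform of `V(ϖ, F)`. [folklore] -/
theorem saturation_le_of_exceptionalLine_le (j : Fin r) (hji : j ≠ i) (hc : IsQuasiRegular c)
    [IsDomain (R ⧸ Ideal.span (Set.range c))] {ϖ : R} (hϖ : ϖ ∉ Ideal.span (Set.range c))
    (hcbar : IsQuasiRegular fun l => Ideal.Quotient.mk (Ideal.span {ϖ}) (c l))
    [IsDomain ((R ⧸ Ideal.span {ϖ}) ⧸ Ideal.span (Set.range fun l => Ideal.Quotient.mk (Ideal.span {ϖ}) (c l)))]
    {u F : R} (hu : Ideal.Quotient.mk (Ideal.span {ϖ}) u ∉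
      Ideal.span (Set.range fun l => Ideal.Quotient.mk (Ideal.span {ϖ}) (c l)))
    (hF : F - u * c j ^ 2 ∈ Ideal.span (Set.range c) ^ 3 ⊔ Ideal.span {ϖ})
    (𝔔 : Ideal (blowupAlgebra (Ideal.span (Set.range c)) (c i)))
    (hfrac : blowupAlgebra.frac c i j ∈ 𝔔)
    (hci : algebraMap R (blowupAlgebra (Ideal.span (Set.range c)) (c i)) (c i) ∈ 𝔔)
    (hϖQ : algebraMap R (blowupAlgebra (Ideal.span (Set.range c)) (c i)) ϖ ∈ 𝔔)
    {g : blowupAlgebra (Ideal.span (Set.range c)) (c i)} {N : ℕ}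
    (hg : algebraMap R (blowupAlgebra (Ideal.span (Set.range c)) (c i)) (c i) ^ N * g ∈
      (Ideal.span {ϖ, F}).map (algebraMap R (blowupAlgebra (Ideal.span (Set.range c)) (c i)))) :
    g ∈ 𝔔 := by
  refine Ideal.span_le.mpr ?_ (saturation_le_exceptionalLine_of_doubledPlaneCone c i j hji hc hϖ hcbar hu hF hg)
  rintro _ (rfl | rfl | h)
  · exact hfrac
  · exact hci
  · rw [Set.mem_singleton_iff.mp h]; exact hϖQ

end Summit.ResolutionOfSingularities.ResolutionOfSingularities.Cruxes.EquisingularLiftNat.Sections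

end
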